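import Summits.Ventures.GridStability.Models.StructurePreservingSynchronization
import Summits.Ventures.GridStability.Models.WSCC9SP
import Summits.Ventures.GridStability.Models.NE39SP
import HarnessLib

/-!
# GridStability/Models/StructurePreservingDichotomyInstances — the global dichotomy of MODEL MV-3
# instantiated BY NAME on the cell's two structure-preserving benchmark records («WSCC9-SP9» canary,
# «NE39SP» = Padiyar App. D 39-bus), for EVERY positive damping vector

LADDER-GRIDFUSION G2 (structure-preserving lever) / G3, seat gridfusion-model-2 (g8); rider
«#104′ SP-PARAMS» of ★ #104 «G2.b-SP-DICHOTOMY-THM» (lead g8 RULING 9h (1)). The theorem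
`Params.IsSolution.desync_or_syncFreq` / `Params.IsSolution.syncFreq_of_cohesive`
(`StructurePreservingSynchronization.lean`, [cite: Chiang1995, §3 Thm 3.1, §6];
[cite: Padiyar2013, §3.2 eqs (3.2)–(3.6)]) read on the records `WSCC9SP.params D` (model-2 p498368,
data `bench/data/WSCC9/sp9/sp9.json` 61008636cbb630ff from [cite: AndersonFouad1977, Table 2.1,
Table 2.2, Ex. 2.6]) and `NE39SP.params D` (model-2 p480737, data `bench/data/NE39/sp49.json` from
[cite: Padiyar2013, App. D]) — the objects ★ #45 / #90 / #94 (SP9) and ★ #53 / ★★ #91′ /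
«G2.b-SP NE39» (NE39SP) are certificates about. Both records DEFINE `P⁰ := f(δ₀)` (eq=b,
redispatched: `Σ P⁰ = 0`, `ω₀ = 0`, `P̄ = P⁰` — `syncFreq_eq_zero`, MODEL-VALIDITY token MV-RD), so
the frame of the printed model is already synchronous and the dichotomy reads: for EVERY damping
vector `D > 0` (no printed D exists — MODEL-VALIDITY Q-MV-3 — so `D` is universally quantified: every
declared D-class of the certificates is covered) and EVERY solution of the printed second-order model
on the record, EITHER the `P⁰`-weighted angle spread `Σᵢ P⁰ᵢ(δᵢ − δₖ)` diverges for every reference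
bus (loss of synchronism between the buses) OR every bus frequency deviation `δ̇ᵢ → 0` (all 9 resp.
49 buses, loads included) and every nodal mismatch `P⁰ᵢ − fᵢ(δ) → 0`; bounded angle differences force
the second. Nothing here decides WHICH alternative a given state takes — that is what the region
certificates on these records do. THREE COLUMNS: mathematics about MODEL MV-3 on two typed data sets
(MODELLED tokens as in `WSCC9SP.lean` / `NE39SP.lean`: «MV-3 + lossless + MV-RD + D⟨universal⟩ +
V-frozen(V1 resp. LF)»; WSCC9-SP9 is the lane CANARY, NOT OF RECORD as a printed system); no kit,
no new literal; never a sentence about the WSCC or New England systems.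
-/

noncomputable section

open Real Set Filter Topology Finset
open Summit.Ventures.GridStability.Models.StructurePreserving

namespace Summit.Ventures.GridStability.Models

/-- **WSCC9-SP9 (canary), every damping `D > 0`: desynchronisation or frequency synchronisation.**
Every solution `δ` of the printed structure-preserving model on `WSCC9SP.params D` EITHER has
`Σᵢ P⁰ᵢ(δᵢ(t) − δₖ(t)) → +∞` for every reference bus `k` (with the free energy `→ −∞`) OR has every
bus frequency deviation `δ̇ᵢ(t) → 0` (`ω₀ = 0` on this redispatched record) and every mismatch
`P⁰ᵢ − fᵢ(δ(t)) → 0`. MODEL MV-3 canary object; not a 9-bus sentence.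
[cite: Chiang1995, §3 Thm 3.1, §6; Padiyar2013, §3.2 eqs (3.2)–(3.6); AndersonFouad1977, Table 2.1] -/
theorem WSCC9SP.desync_or_syncFreq {D : Fin 9 → ℝ} (hD : ∀ i, 0 < D i) {δ : ℝ → Fin 9 → ℝ}
    (hδ : (WSCC9SP.params D).IsSolution δ) :
    (Tendsto (fun t => (WSCC9SP.params D).freeEnergy ((WSCC9SP.params D).toPhase δ t)) atTop atBot ∧
        ∀ k, Tendsto (fun t => ∑ i, (WSCC9SP.params D).P0 i * (δ t i - δ t k)) atTop atTop) ∨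
      ((∃ e : ℝ, Tendsto (fun t => (WSCC9SP.params D).freeEnergy ((WSCC9SP.params D).toPhase δ t))
          atTop (𝓝 e)) ∧
        (∀ i, Tendsto (fun t => deriv (fun u => δ u i) t) atTop (𝓝 0)) ∧
        ∀ i, Tendsto (fun t => (WSCC9SP.params D).P0 i - (WSCC9SP.params D).pe (δ t) i)
          atTop (𝓝 0)) := by
  have h := Params.IsSolution.desync_or_syncFreq (WSCC9SP.wellFormed hD) (by decide) hδ
  have hs : (WSCC9SP.params D).shifted = WSCC9SP.params D :=
    (WSCC9SP.params D).shifted_eq_self_of_P0_eq_pe WSCC9SP.b_symm (WSCC9SP.params_P0 D)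
  have hP : (WSCC9SP.params D).Pbar = (WSCC9SP.params D).P0 :=
    (WSCC9SP.params D).Pbar_eq_P0_of_P0_eq_pe WSCC9SP.b_symm (WSCC9SP.params_P0 D)
  simp only [hs, hP, WSCC9SP.syncFreq_eq_zero D, zero_mul, sub_zero] at h
  exact h

/-- **WSCC9-SP9 (canary): cohesive ⇒ frequency synchronisation of all 9 buses**, every `D > 0`:
bounded angle differences along a solution (any bound) force `δ̇ᵢ(t) → 0` at every bus and every
mismatch `→ 0`. MODEL MV-3 canary object. [cite: Chiang1995, §3 Thm 3.1, §6; Padiyar2013, §3.2 eqs (3.2)–(3.6)] -/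
theorem WSCC9SP.syncFreq_of_cohesive {D : Fin 9 → ℝ} (hD : ∀ i, 0 < D i) {δ : ℝ → Fin 9 → ℝ}
    (hδ : (WSCC9SP.params D).IsSolution δ) {B : ℝ}
    (hB : ∀ t, 0 ≤ t → ∀ i j, |δ t i - δ t j| ≤ B) :
    (∀ i, Tendsto (fun t => deriv (fun u => δ u i) t) atTop (𝓝 0)) ∧
      ∀ i, Tendsto (fun t => (WSCC9SP.params D).P0 i - (WSCC9SP.params D).pe (δ t) i)
        atTop (𝓝 0) := by
  have h := Params.IsSolution.syncFreq_of_cohesive (WSCC9SP.wellFormed hD) (by decide) hδ hB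
  have hP : (WSCC9SP.params D).Pbar = (WSCC9SP.params D).P0 :=
    (WSCC9SP.params D).Pbar_eq_P0_of_P0_eq_pe WSCC9SP.b_symm (WSCC9SP.params_P0 D)
  simp only [hP, WSCC9SP.syncFreq_eq_zero D] at h
  exact h

/-- **NE39SP (Padiyar App. D 39-bus structure-preserving record, 49 nodes), every damping `D > 0`:
desynchronisation or frequency synchronisation.** Every solution `δ` of the printed
structure-preserving model on `NE39SP.params D` EITHER has `Σᵢ P⁰ᵢ(δᵢ(t) − δₖ(t)) → +∞` for every
reference bus `k` (free energy `→ −∞`) OR has every bus frequency deviation `δ̇ᵢ(t) → 0` (`ω₀ = 0`,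
redispatched record) and every mismatch `P⁰ᵢ − fᵢ(δ(t)) → 0`. MODEL MV-3 («MV-3 + lossless + MV-RD +
D⟨universal⟩ + V-frozen(LF)»); not a New England sentence.
[cite: Chiang1995, §3 Thm 3.1, §6; Padiyar2013, §3.2 eqs (3.2)–(3.6), App. D] -/
theorem NE39SP.desync_or_syncFreq {D : Fin 49 → ℝ} (hD : ∀ i, 0 < D i) {δ : ℝ → Fin 49 → ℝ}
    (hδ : (NE39SP.params D).IsSolution δ) :
    (Tendsto (fun t => (NE39SP.params D).freeEnergy ((NE39SP.params D).toPhase δ t)) atTop atBot ∧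
        ∀ k, Tendsto (fun t => ∑ i, (NE39SP.params D).P0 i * (δ t i - δ t k)) atTop atTop) ∨
      ((∃ e : ℝ, Tendsto (fun t => (NE39SP.params D).freeEnergy ((NE39SP.params D).toPhase δ t))
          atTop (𝓝 e)) ∧
        (∀ i, Tendsto (fun t => deriv (fun u => δ u i) t) atTop (𝓝 0)) ∧
        ∀ i, Tendsto (fun t => (NE39SP.params D).P0 i - (NE39SP.params D).pe (δ t) i)
          atTop (𝓝 0)) := by
  have h := Params.IsSolution.desync_or_syncFreq (NE39SP.wellFormed hD) (by decide) hδ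
  have hs : (NE39SP.params D).shifted = NE39SP.params D :=
    (NE39SP.params D).shifted_eq_self_of_P0_eq_pe NE39SP.b_symm (NE39SP.params_P0 D)
  have hP : (NE39SP.params D).Pbar = (NE39SP.params D).P0 :=
    (NE39SP.params D).Pbar_eq_P0_of_P0_eq_pe NE39SP.b_symm (NE39SP.params_P0 D)
  simp only [hs, hP, NE39SP.syncFreq_eq_zero D, zero_mul, sub_zero] at h
  exact h

/-- **NE39SP: cohesive ⇒ frequency synchronisation of all 49 nodes**, every `D > 0`: bounded angle
differences along a solution (any bound) force `δ̇ᵢ(t) → 0` at every bus and every mismatch `→ 0`.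
MODEL MV-3 record; not a New England sentence. [cite: Chiang1995, §3 Thm 3.1, §6; Padiyar2013, §3.2 eqs (3.2)–(3.6), App. D] -/
theorem NE39SP.syncFreq_of_cohesive {D : Fin 49 → ℝ} (hD : ∀ i, 0 < D i) {δ : ℝ → Fin 49 → ℝ}
    (hδ : (NE39SP.params D).IsSolution δ) {B : ℝ}
    (hB : ∀ t, 0 ≤ t → ∀ i j, |δ t i - δ t j| ≤ B) :
    (∀ i, Tendsto (fun t => deriv (fun u => δ u i) t) atTop (𝓝 0)) ∧
      ∀ i, Tendsto (fun t => (NE39SP.params D).P0 i - (NE39SP.params D).pe (δ t) i)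
        atTop (𝓝 0) := by
  have h := Params.IsSolution.syncFreq_of_cohesive (NE39SP.wellFormed hD) (by decide) hδ hB
  have hP : (NE39SP.params D).Pbar = (NE39SP.params D).P0 :=
    (NE39SP.params D).Pbar_eq_P0_of_P0_eq_pe NE39SP.b_symm (NE39SP.params_P0 D)
  simp only [hP, NE39SP.syncFreq_eq_zero D] at h
  exact h

end Summit.Ventures.GridStability.Models

end
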